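import Mathlib
import Literature.Computability.Complexity.RangeAvoidance
import Literature.Computability.Complexity.SignDegreeXor
import Summits.PneNP.PneNP.Theorems.PstarPDT
import Summits.PneNP.PneNP.Theorems.PstarFibrePolys
import Summits.PneNP.PneNP.Theorems.PstarSALevel
import Summits.PneNP.PneNP.Theorems.PstarSAClosure
import Summits.PneNP.PneNP.Theorems.PstarTyped
import Summits.PneNP.PneNP.Theorems.PstarGapLemma
import Summits.PneNP.PneNP.Theorems.PstarGapLinearised
import Summits.PneNP.PneNP.Theorems.PstarGapPeeling
import Summits.PneNP.PneNP.Theorems.PstarGapAdversary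
import Summits.PneNP.PneNP.Theorems.PstarChordRepair
import Summits.PneNP.PneNP.Theorems.PstarNoDeadCentre
import Summits.PneNP.PneNP.Theorems.PstarCentreFree
import Summits.PneNP.PneNP.Theorems.PstarGapOneAnd
import Summits.PneNP.PneNP.Theorems.PstarGraphQuadGapOne
import Summits.PneNP.PneNP.Theorems.PstarGraphQuadGapTwoForms
import Summits.PneNP.PneNP.Theorems.PstarGapOneAll
import Summits.PneNP.PneNP.Theorems.PstarGConstraint
import Summits.PneNP.PneNP.Theorems.PstarGSatChord

/-!
# The reader-graph induction: chord structure (c) and the no-chord contradiction (d) (ROUND-24 item T24.17′, steps)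

FRONTIER range-avoidance ladder, rung F-N3, ROUND 24 (cell `pnp-ideate`; restricted-model proof complexity — nothing here bears on
`P` versus `NP`).  Memo ROUND-24-PRESEED §13 R10(p) (c),(d); referee AUDIT-r10p-gsat-g43 (P3, P6).

* **`chord_structure`** (memo (c)): in the inductive step (unsat assumption + IH on `J ∖ g`), a CHORD `g ∈ J` (AND pair `p, p'` read
  by no other output of `J`) forces the restricted constraint `Q = w|_{p = p' = 1}` to be constant on the solutions of `J ∖ g`
  (`PstarGSatChord.gval_one_one`); `Q` is itself a legal G-constraint `κ ⊕ gval C″ G″` with `G″ =` the pairs of `G` avoiding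
  `{p,p'}` and `C″ = (C ∖ {p,p'}) ∆ N_G(p) ∆ N_G(p')` (`bit_gval_restrict`), so the IH makes it constant everywhere and
  `PstarGConstraint.eq_empty_of_gval_const` gives **`C″ = ∅ ∧ G″ = ∅`**: every pair of `G` meets `{p,p'}` and
  `C ∖ {p,p'} = N_G(p) ∆ N_G(p')`.
* **`no_chord_false`** (memo (d)): if `J ≠ ∅` has no chord, no reader and every private XOR slot in `C`, expansion gives an output `f`
  with one private XOR slot `t` and one private AND slot `p` (other AND slot `d`); toggling `p` (when `z_d = 0`) and `t, p`
  (when `z_d = 1`) inside the solution set shows `alpha z p = z_d` on `Sol(J)`, i.e. the AND-typed parity `⊕_{N_G(p) ∪ {d}} = [p ∈ C]`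
  holds on all of `Sol(J)` — so its negation is infeasible, and `PstarGapOneAnd.gapOneAnd` (T24.16) with
  `PstarGapAdversary.exists_minInfeasible_subset` refutes that.
-/

set_option linter.dupNamespace false -- `Summit.PneNP.PneNP.…`: summit = sub-problem name (D-0017 single-conjunct layout)

open Finset Literature.Computability.Complexity
open scoped symmDiff
open Summit.PneNP.PneNP.Theorems.PstarPDT (parity)
open Summit.PneNP.PneNP.Theorems.PstarFibrePolys (bit bit_injective)
open Summit.PneNP.PneNP.Theorems.PstarTyped (Typed)
open Summit.PneNP.PneNP.Theorems.PstarSALevel (varSet bdry BoundaryExpanding SimpleOverlap)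
open Summit.PneNP.PneNP.Theorems.PstarSAClosure (exists_two_private)
open Summit.PneNP.PneNP.Theorems.PstarGapLemma (Sat Feasible MinInfeasible)
open Summit.PneNP.PneNP.Theorems.PstarGapLinearised (andPair)
open Summit.PneNP.PneNP.Theorems.PstarGapPeeling (not_mem_varSet_of_private eval_update_of_not_mem eval_pure eval_update_xor_slot)
open Summit.PneNP.PneNP.Theorems.PstarGapAdversary (exists_minInfeasible_subset)
open Summit.PneNP.PneNP.Theorems.PstarNoDeadCentre (IsAndVar GapOneAnd)
open Summit.PneNP.PneNP.Theorems.PstarCentreFree (vars_mem_varSet)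
open Summit.PneNP.PneNP.Theorems.PstarChordRepair (IsChord)
open Summit.PneNP.PneNP.Theorems.PstarGraphQuadGapOne (bit_parity)
open Summit.PneNP.PneNP.Theorems.PstarGraphQuadGapTwoForms (sum_symmDiff_zmod2)
open Summit.PneNP.PneNP.Theorems.PstarGapOneAll (gval)
open Summit.PneNP.PneNP.Theorems.PstarGConstraint
open Summit.PneNP.PneNP.Theorems.PstarGSatChord

namespace Summit.PneNP.PneNP.Theorems.PstarGSatStructure

variable {n m : ℕ}

/-- In `𝔽₂`, `x + x = 0`. -/
private theorem zmod2_add_self (x : ZMod 2) : x + x = 0 := by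
  revert x; decide

/-! ## Neighbourhoods in the pair graph of `G` -/

/-- The `G`-outputs whose AND pair contains `p`. -/
noncomputable def Gp (I : LocalMap 4 n m) (G : Finset (Fin m)) (p : Fin n) : Finset (Fin m) := by
  classical exact G.filter fun g => p ∈ andPair I g

/-- `N_G(p)`: the far ends of the pairs of `G` through `p`. -/
noncomputable def nbG (I : LocalMap 4 n m) (G : Finset (Fin m)) (p : Fin n) : Finset (Fin n) := by
  classical exact (Gp I G p).image fun g => other I g p

/-- Membership in `Gp`. -/
theorem mem_Gp {I : LocalMap 4 n m} {G : Finset (Fin m)} {p : Fin n} {g : Fin m} : g ∈ Gp I G p ↔ g ∈ G ∧ p ∈ andPair I g := by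
  classical
  unfold Gp
  rw [mem_filter]

/-- Membership in `N_G(p)`. -/
theorem mem_nbG {I : LocalMap 4 n m} {G : Finset (Fin m)} {p x : Fin n} :
    x ∈ nbG I G p ↔ ∃ g ∈ G, p ∈ andPair I g ∧ other I g p = x := by
  classical
  unfold nbG
  rw [mem_image]
  constructor
  · rintro ⟨g, hg, rfl⟩
    exact ⟨g, (mem_Gp.1 hg).1, (mem_Gp.1 hg).2, rfl⟩
  · rintro ⟨g, hg, hp, rfl⟩
    exact ⟨g, mem_Gp.2 ⟨hg, hp⟩, rfl⟩

/-- `other` is injective on `Gp` when the pairs of `G` are distinct. -/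
theorem other_injOn (I : LocalMap 4 n m) {G : Finset (Fin m)} (hdist : ∀ g ∈ G, ∀ g' ∈ G, g ≠ g' → andPair I g ≠ andPair I g')
    (p : Fin n) : Set.InjOn (fun g => other I g p) (Gp I G p : Set (Fin m)) := by
  intro g hg g' hg' h
  obtain ⟨hgG, hgp⟩ := mem_Gp.1 (mem_coe.1 hg)
  obtain ⟨hg'G, hg'p⟩ := mem_Gp.1 (mem_coe.1 hg')
  by_contra hne
  apply hdist g hgG g' hg'G hne
  rw [← pair_eq_of_mem I p hgp, ← pair_eq_of_mem I p hg'p]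
  exact congrArg _ (congrArg _ h)

/-- `alpha` as a sum over `N_G(p)`. -/
theorem alpha_eq (I : LocalMap 4 n m) (C : Finset (Fin n)) {G : Finset (Fin m)}
    (hdist : ∀ g ∈ G, ∀ g' ∈ G, g ≠ g' → andPair I g ≠ andPair I g') (z : Fin n → Bool) (p : Fin n) :
    alpha I C G z p = (if p ∈ C then 1 else 0) + ∑ x ∈ nbG I G p, bit (z x) := by
  classical
  unfold alpha nbG
  rw [sum_image (other_injOn I hdist p)]
  rfl

/-- Elements of `N_G(p)` are AND-slot variables of outputs of `G`, and differ from `p`. -/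
theorem mem_nbG_and {I : LocalMap 4 n m} {G : Finset (Fin m)} (hnd : ∀ g ∈ G, I.vars g 2 ≠ I.vars g 3) {p x : Fin n}
    (hx : x ∈ nbG I G p) : ∃ g ∈ G, (I.vars g 2 = x ∨ I.vars g 3 = x) ∧ x ≠ p ∧ x ∈ andPair I g := by
  obtain ⟨g, hg, hp, rfl⟩ := mem_nbG.1 hx
  refine ⟨g, hg, ?_, other_ne I (hnd g hg) p hp, ?_⟩
  · unfold other
    split_ifs
    · exact Or.inr rfl
    · exact Or.inl rfl
  · have := pair_eq_of_mem I p hp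
    rw [← this]
    simp

/-! ## (c) The chord structure -/

section Structure

variable (I : LocalMap 4 n m) (hI : I.IsPure xorAndPred) (hT : Typed I) (hS : SimpleOverlap I) (y : Fin m → Bool)
  (J G : Finset (Fin m)) (C : Finset (Fin n)) (b : Bool) (hJG : Disjoint J G)
  (hunsat : ∀ z : Fin n → Bool, (∀ j ∈ J, I.eval z j = y j) → gval I C G z ≠ b)
  (ih : ∀ g ∈ J, ∀ (G' : Finset (Fin m)) (C' : Finset (Fin n)) (b' : Bool), Disjoint (J.erase g) G' →
    (∃ z z' : Fin n → Bool, gval I C' G' z ≠ gval I C' G' z') →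
      ∃ z : Fin n → Bool, (∀ j ∈ J.erase g, I.eval z j = y j) ∧ gval I C' G' z = b')

/-- **Restriction of a G-constraint to `p = p' = 1`** is again a G-constraint, up to a constant:
`bit (gval C G (z[p↦1][p'↦1])) = [p∈C] + [p'∈C] + bit (gval C″ G″ z)` with `G″ =` pairs avoiding `{p,p'}` and
`C″ = (C ∖ {p,p'}) ∆ N_G(p) ∆ N_G(p')`, provided no pair of `G` is `{p,p'}` and the pairs are distinct and non-degenerate. -/
theorem bit_gval_restrict {p p' : Fin n} (hpp : p ≠ p') (hnd : ∀ g ∈ G, I.vars g 2 ≠ I.vars g 3)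
    (hdist : ∀ g ∈ G, ∀ g' ∈ G, g ≠ g' → andPair I g ≠ andPair I g') (hno : ∀ g ∈ G, andPair I g ≠ {p, p'})
    (z : Fin n → Bool) :
    bit (gval I C G (Function.update (Function.update z p true) p' true)) =
      (if p ∈ C then 1 else 0) + (if p' ∈ C then 1 else 0) +
        bit (gval I (((C.erase p).erase p') ∆ nbG I G p ∆ nbG I G p')
          (G.filter fun g => p ∉ andPair I g ∧ p' ∉ andPair I g) z) := by
  classical
  set z₁ := Function.update (Function.update z p true) p' true with hz₁
  have hz₁p : z₁ p = true := by rw [hz₁, Function.update_of_ne hpp, Function.update_self]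
  have hz₁p' : z₁ p' = true := by rw [hz₁, Function.update_self]
  have hz₁o : ∀ w, w ≠ p → w ≠ p' → z₁ w = z w := fun w hw hw' => by
    rw [hz₁, Function.update_of_ne hw', Function.update_of_ne hw]
  -- far ends avoid `p, p'`
  have hfar : ∀ {q x : Fin n}, x ∈ nbG I G q → (q = p ∨ q = p') → x ≠ p ∧ x ≠ p' := by
    intro q x hx hq
    obtain ⟨g, hg, hqp, rfl⟩ := mem_nbG.1 hx
    have hne := other_ne I (hnd g hg) q hqp
    have hpair := pair_eq_of_mem I q hqp
    rcases hq with rfl | rfl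
    · refine ⟨hne, fun h => hno g hg ?_⟩
      rw [← hpair, h]
    · refine ⟨fun h => hno g hg ?_, hne⟩
      rw [← hpair, h, pair_comm]
  rw [bit_gval, bit_gval, sum_symmDiff_zmod2, sum_symmDiff_zmod2]
  -- the `C` part
  have hC : ∑ v ∈ C, bit (z₁ v) = (if p ∈ C then 1 else 0) + (if p' ∈ C then 1 else 0) + ∑ v ∈ (C.erase p).erase p', bit (z v) := by
    have e1 : ∀ (S : Finset (Fin n)) (q : Fin n), z₁ q = true →
        ∑ v ∈ S, bit (z₁ v) = (if q ∈ S then 1 else 0) + ∑ v ∈ S.erase q, bit (z₁ v) := by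
      intro S q hq
      by_cases h : q ∈ S
      · rw [if_pos h, ← add_sum_erase S _ h, hq]; rfl
      · rw [if_neg h, zero_add, erase_eq_of_notMem h]
    rw [e1 C p hz₁p, e1 (C.erase p) p' hz₁p']
    have hp'C : (p' ∈ C.erase p) = (p' ∈ C) := by rw [mem_erase]; exact propext ⟨fun h => h.2, fun h => ⟨hpp.symm, h⟩⟩
    simp only [hp'C]
    have : ∑ v ∈ (C.erase p).erase p', bit (z₁ v) = ∑ v ∈ (C.erase p).erase p', bit (z v) :=
      sum_congr rfl fun v hv => by
        rw [hz₁o v (mem_erase.1 (mem_erase.1 hv).2).1 (mem_erase.1 hv).1]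
    rw [this]
    ring
  -- the `G` part
  have hG : ∑ g ∈ G, bit (z₁ (I.vars g 2)) * bit (z₁ (I.vars g 3)) =
      ∑ g ∈ G.filter (fun g => p ∉ andPair I g ∧ p' ∉ andPair I g), bit (z (I.vars g 2)) * bit (z (I.vars g 3)) +
        ∑ x ∈ nbG I G p, bit (z x) + ∑ x ∈ nbG I G p', bit (z x) := by
    unfold nbG
    rw [sum_image (other_injOn I hdist p), sum_image (other_injOn I hdist p')]
    unfold Gp
    rw [sum_filter, sum_filter, sum_filter, ← sum_add_distrib, ← sum_add_distrib]
    refine sum_congr rfl fun g hg => ?_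
    have hgnd := hnd g hg
    by_cases h2p : I.vars g 2 = p
    · -- pair `{p, x}` with `x = vars g 3 ∉ {p,p'}`
      have hmem : p ∈ andPair I g := (mem_andPair_iff I g p).2 (Or.inl h2p)
      have hx : I.vars g 3 ≠ p ∧ I.vars g 3 ≠ p' := by
        have := hfar (mem_nbG.2 ⟨g, hg, hmem, rfl⟩) (Or.inl rfl)
        unfold other at this; rwa [if_pos h2p] at this
      have hp' : p' ∉ andPair I g := fun h => by
        rcases (mem_andPair_iff I g p').1 h with e | e
        · exact hpp (h2p.symm.trans e)
        · exact hx.2 e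
      rw [if_neg (fun h => h.1 hmem), if_pos hmem, if_neg hp', h2p, hz₁p, hz₁o _ hx.1 hx.2]
      unfold other; rw [if_pos h2p]
      simp [show bit true = (1 : ZMod 2) from rfl]
    · by_cases h3p : I.vars g 3 = p
      · have hmem : p ∈ andPair I g := (mem_andPair_iff I g p).2 (Or.inr h3p)
        have hx : I.vars g 2 ≠ p ∧ I.vars g 2 ≠ p' := by
          have := hfar (mem_nbG.2 ⟨g, hg, hmem, rfl⟩) (Or.inl rfl)
          unfold other at this; rwa [if_neg h2p] at this
        have hp' : p' ∉ andPair I g := fun h => by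
          rcases (mem_andPair_iff I g p').1 h with e | e
          · exact hx.2 e
          · exact hpp (h3p.symm.trans e)
        rw [if_neg (fun h => h.1 hmem), if_pos hmem, if_neg hp', h3p, hz₁p, hz₁o _ hx.1 hx.2]
        unfold other; rw [if_neg h2p]
        simp [show bit true = (1 : ZMod 2) from rfl]
      · have hpn : p ∉ andPair I g := fun h => by
          rcases (mem_andPair_iff I g p).1 h with e | e
          exacts [h2p e, h3p e]
        by_cases h2p' : I.vars g 2 = p'
        · have hmem : p' ∈ andPair I g := (mem_andPair_iff I g p').2 (Or.inl h2p')
          have hx : I.vars g 3 ≠ p ∧ I.vars g 3 ≠ p' := by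
            have := hfar (mem_nbG.2 ⟨g, hg, hmem, rfl⟩) (Or.inr rfl)
            unfold other at this; rwa [if_pos h2p'] at this
          rw [if_neg (fun h => h.2 hmem), if_neg hpn, if_pos hmem, h2p', hz₁p', hz₁o _ hx.1 hx.2]
          unfold other; rw [if_pos h2p']
          simp [show bit true = (1 : ZMod 2) from rfl]
        · by_cases h3p' : I.vars g 3 = p'
          · have hmem : p' ∈ andPair I g := (mem_andPair_iff I g p').2 (Or.inr h3p')
            have hx : I.vars g 2 ≠ p ∧ I.vars g 2 ≠ p' := ⟨h2p, h2p'⟩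
            rw [if_neg (fun h => h.2 hmem), if_neg hpn, if_pos hmem, h3p', hz₁p', hz₁o _ hx.1 hx.2]
            unfold other; rw [if_neg h2p']
            simp [show bit true = (1 : ZMod 2) from rfl]
          · have hp'n : p' ∉ andPair I g := fun h => by
              rcases (mem_andPair_iff I g p').1 h with e | e
              exacts [h2p' e, h3p' e]
            rw [if_pos ⟨hpn, hp'n⟩, if_neg hpn, if_neg hp'n, hz₁o _ h2p h2p', hz₁o _ h3p h3p']
            ring
  rw [hC, hG]
  ring

include hI hS hJG hunsat ih

/-- **(c) The chord structure.**  For a chord `g ∈ J`: `C″ = ∅` and `G″ = ∅`. -/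
theorem chord_structure {g : Fin m} (hg : g ∈ J) (hpriv2 : ∀ j ∈ J, j ≠ g → I.vars g 2 ∉ varSet I j)
    (hpriv3 : ∀ j ∈ J, j ≠ g → I.vars g 3 ∉ varSet I j) :
    ((C.erase (I.vars g 2)).erase (I.vars g 3)) ∆ nbG I G (I.vars g 2) ∆ nbG I G (I.vars g 3) = ∅ ∧
      (G.filter fun g' => I.vars g 2 ∉ andPair I g' ∧ I.vars g 3 ∉ andPair I g') = ∅ := by
  classical
  obtain ⟨hnd, hdist⟩ := andPairs_simple I hI hS G
  have h23 : I.vars g 2 ≠ I.vars g 3 := fun h => absurd (hI.2 g h) (by decide)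
  -- no pair of `G` is the pair of `g` (simple overlaps)
  have hno : ∀ g' ∈ G, andPair I g' ≠ {I.vars g 2, I.vars g 3} := by
    intro g' hg' h
    have hne : g' ≠ g := fun e => disjoint_left.1 hJG hg (e ▸ hg')
    have := (andPairs_simple I hI hS (insert g G)).2 g' (mem_insert_of_mem hg') g (mem_insert_self _ _) hne
    exact this (by rw [h]; rfl)
  obtain ⟨C'', hC''⟩ : ∃ C'' : Finset (Fin n),
      C'' = ((C.erase (I.vars g 2)).erase (I.vars g 3)) ∆ nbG I G (I.vars g 2) ∆ nbG I G (I.vars g 3) := ⟨_, rfl⟩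
  obtain ⟨G'', hG''⟩ : ∃ G'' : Finset (Fin m),
      G'' = G.filter (fun g' => I.vars g 2 ∉ andPair I g' ∧ I.vars g 3 ∉ andPair I g') := ⟨_, rfl⟩
  rw [← hC'', ← hG'']
  -- `Q ≡ ¬b` on `Sol(J ∖ g)`, in the form `gval C″ G″ ≡ β`
  obtain ⟨β, hβ⟩ : ∃ β : Bool, bit β = bit (!b) + (if I.vars g 2 ∈ C then 1 else 0) + (if I.vars g 3 ∈ C then 1 else 0) := by
    have h01 : ∀ x : ZMod 2, x = bit false ∨ x = bit true := by decide
    rcases h01 (bit (!b) + (if I.vars g 2 ∈ C then 1 else 0) + (if I.vars g 3 ∈ C then 1 else 0)) with h | h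
    exacts [⟨false, h.symm⟩, ⟨true, h.symm⟩]
  have hQ : ∀ z : Fin n → Bool, (∀ j ∈ J.erase g, I.eval z j = y j) → gval I C'' G'' z = β := by
    intro z hz
    have h11 := gval_one_one I hI y J G C b hnd hunsat hpriv2 hpriv3 hno (z := z)
      (fun j hj hne => hz j (mem_erase.2 ⟨hne, hj⟩))
    have e := bit_gval_restrict I G C h23 hnd hdist hno z
    rw [h11, ← hC'', ← hG''] at e
    apply bit_injective
    rw [hβ]
    have := zmod2_add_self ((if I.vars g 2 ∈ C then (1 : ZMod 2) else 0) + (if I.vars g 3 ∈ C then 1 else 0))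
    linear_combination -e - this
  -- hence `gval C″ G″` is constant (else the IH would realise `¬β` on a solution of `J ∖ g`)
  have hconst : ∀ z z' : Fin n → Bool, gval I C'' G'' z = gval I C'' G'' z' := by
    by_contra hne
    push Not at hne
    obtain ⟨z, z', hzz⟩ := hne
    have hdis : Disjoint (J.erase g) G'' := by
      rw [hG'']
      exact disjoint_of_subset_left (erase_subset _ _) (disjoint_of_subset_right (filter_subset _ _) hJG)
    obtain ⟨w, hw, hwb⟩ := ih g hg G'' C'' (!β) hdis ⟨z, z', hzz⟩
    have := hQ w hw
    rw [hwb] at this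
    revert this; cases β <;> decide
  obtain ⟨z₀⟩ : Nonempty (Fin n → Bool) := ⟨fun _ => false⟩
  have hnd'' : ∀ g' ∈ G'', I.vars g' 2 ≠ I.vars g' 3 := fun g' hg' => hnd g' (mem_filter.1 (hG'' ▸ hg')).1
  have hdist'' : ∀ g₁ ∈ G'', ∀ g₂ ∈ G'', g₁ ≠ g₂ → andPair I g₁ ≠ andPair I g₂ := fun g₁ h₁ g₂ h₂ =>
    hdist g₁ (mem_filter.1 (hG'' ▸ h₁)).1 g₂ (mem_filter.1 (hG'' ▸ h₂)).1
  exact eq_empty_of_gval_const I hnd'' hdist'' (b := gval I C'' G'' z₀) fun z => hconst z z₀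

end Structure

/-! ## Consequences of the chord structure -/

/-- The far end of a pair, from two distinct members. -/
theorem other_eq_of_mem (I : LocalMap 4 n m) {g : Fin m} {u v : Fin n} (hu : u ∈ andPair I g) (hv : v ∈ andPair I g) (huv : u ≠ v) :
    other I g v = u := by
  unfold other
  by_cases h2 : I.vars g 2 = v
  · rw [if_pos h2]
    rcases (mem_andPair_iff I g u).1 hu with h' | h'
    · exact absurd (h'.symm.trans h2) huv
    · exact h'
  · rw [if_neg h2]
    rcases (mem_andPair_iff I g u).1 hu with h' | h'
    · exact h'
    · rcases (mem_andPair_iff I g v).1 hv with h | h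
      · exact absurd h h2
      · exact absurd (h'.symm.trans h) huv

section Consequences

variable (I : LocalMap 4 n m) (J G : Finset (Fin m)) (C : Finset (Fin n))
  (hstruct : ∀ g ∈ J, IsChord I J g →
    ((C.erase (I.vars g 2)).erase (I.vars g 3)) ∆ nbG I G (I.vars g 2) ∆ nbG I G (I.vars g 3) = ∅ ∧
      (G.filter fun g' => I.vars g 2 ∉ andPair I g' ∧ I.vars g 3 ∉ andPair I g') = ∅)

include hstruct

/-- From the structure at a chord `g`: every element of `C` other than `g`'s AND pair lies in `N_G(p) ∪ N_G(p')`. -/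
theorem mem_C_imp {g : Fin m} (hg : g ∈ J) (hc : IsChord I J g) {v : Fin n} (hv : v ∈ C) (h2 : v ≠ I.vars g 2)
    (h3 : v ≠ I.vars g 3) : v ∈ nbG I G (I.vars g 2) ∨ v ∈ nbG I G (I.vars g 3) := by
  have e := (hstruct g hg hc).1
  by_contra hno
  push Not at hno
  have hA : v ∈ (C.erase (I.vars g 2)).erase (I.vars g 3) := mem_erase.2 ⟨h3, mem_erase.2 ⟨h2, hv⟩⟩
  have : v ∈ ((C.erase (I.vars g 2)).erase (I.vars g 3)) ∆ nbG I G (I.vars g 2) ∆ nbG I G (I.vars g 3) := by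
    rw [mem_symmDiff]
    exact Or.inl ⟨by rw [mem_symmDiff]; exact Or.inl ⟨hA, hno.1⟩, hno.2⟩
  rw [e] at this
  exact notMem_empty v this

/-- Every pair of `G` meets the AND pair of every chord. -/
theorem meets_of_chord {g : Fin m} (hg : g ∈ J) (hc : IsChord I J g) {g' : Fin m} (hg' : g' ∈ G) :
    I.vars g 2 ∈ andPair I g' ∨ I.vars g 3 ∈ andPair I g' := by
  have e := (hstruct g hg hc).2
  by_contra hno
  push Not at hno
  have : g' ∈ G.filter (fun g' => I.vars g 2 ∉ andPair I g' ∧ I.vars g 3 ∉ andPair I g') := mem_filter.2 ⟨hg', hno⟩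
  rw [e] at this
  exact notMem_empty g' this

/-- Far ends of `G`-pairs through a chord `g` lie in the AND pair of any other chord `g'`. -/
theorem far_mem {g g' : Fin m} (hg : g ∈ J) (hc : IsChord I J g) (hg' : g' ∈ J) (hc' : IsChord I J g') (hgg : g ≠ g')
    (s : Fin 4) (hs : 2 ≤ s.val) {x : Fin n} (hx : x ∈ nbG I G (I.vars g s)) : x = I.vars g' 2 ∨ x = I.vars g' 3 := by
  obtain ⟨k, hk, hmem, hox⟩ := mem_nbG.1 hx
  have hpair := pair_eq_of_mem I (I.vars g s) hmem
  have hm := meets_of_chord I J G C hstruct hg' hc' hk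
  rw [← hpair, mem_insert, mem_singleton, mem_insert, mem_singleton, hox] at hm
  have hPg : ∀ j ∈ J, j ≠ g → I.vars g s ∉ varSet I j := by
    intro j hj hjg
    have : s = 2 ∨ s = 3 := by fin_cases s <;> simp at hs ⊢
    rcases this with rfl | rfl
    · exact not_mem_varSet_of_private I hg hj hjg hc.1 (vars_mem_varSet I g 2)
    · exact not_mem_varSet_of_private I hg hj hjg hc.2 (vars_mem_varSet I g 3)
  have hne2 : I.vars g' 2 ≠ I.vars g s := fun h => hPg g' hg' (Ne.symm hgg) (h ▸ vars_mem_varSet I g' 2)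
  have hne3 : I.vars g' 3 ≠ I.vars g s := fun h => hPg g' hg' (Ne.symm hgg) (h ▸ vars_mem_varSet I g' 3)
  rcases hm with (h | h) | (h | h)
  · exact absurd h hne2
  · exact Or.inl h.symm
  · exact absurd h hne3
  · exact Or.inr h.symm

end Consequences

end Summit.PneNP.PneNP.Theorems.PstarGSatStructure
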